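import Summits.QuantumAdvantage.QuantumAdvantage.Theorems.CharDialBlockDialB
import HarnessLib

/-!
# The block dial, part C: the pieces tile the cube — `sum_card_Bset`, `card_Bset_win_le` (decomp-qadv lens-6 g17 «OrbitDial», tree part 30O)

For a fixed family of `M` separated `p`-blocks, `Bset p S u w` re-sets exactly the blocks that are CONSTANT under `u` (to the bits `w k`) and keeps the
rest; `(u, w) ↦ (Bset u w, mix u w)` is an involution of `{0,1}ⁿ × {0,1}^M` (`Bset_Bset_mix`, `mix_Bset_mix`), whence the TILING IDENTITY
`sum_card_Bset : Σ_u #{w | P (Bset u w)} = 2^M · #{u | P u}`.  `card_Bset_win_le` transports a piece bound (hypothesis, the shape of `blockPiece_hard`)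
to `{0,1}^M` through the subcube calculus on the block cube (`Subcube.card_filter_merge_le`, free blocks re-indexed by `Subcube.emb`).
Supports item stmt-QuantumAdvantage-32604 (`CharDial.WalkHardFJLinOdd`); source: pub annex g17/OrbitDial37.lean §37q REV12 (sha256 7a2cb935…), namespace `…Theses.OrbitDial.BlockDial`, statements and proofs verbatim with the Prop abbreviations `InBlk`/`IsConst`/`BlkSep` INLINED (Prop-free twin).
-/

set_option autoImplicit false

namespace Summit.QuantumAdvantage.AdviceFreeQNC0.JLinPeel.BlockDial

open Finset
open Summit.QuantumAdvantage.AdviceFreeQNC0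
open Literature.Computability.MetaComplexity Literature.Computability.MetaComplexity.Smolensky

section BlockDial
open Classical
variable {n M : ℕ} {p : ℕ} {S : Fin M → ℕ}


/-! #### the GLOBAL assembly: pieces through every input, tiling, and the constant-block tail -/


/-- the constant blocks of `u` (its FREE blocks). -/
noncomputable def cblk (p : ℕ) (S : Fin M → ℕ) (u : Fin n → Bool) : Finset (Fin M) := univ.filter fun k => (∀ x₁ x₂ : Fin n, (S k ≤ x₁.val ∧ x₁.val < S k + p) → (S k ≤ x₂.val ∧ x₂.val < S k + p) → u x₁ = u x₂)

/-- the bit carried by block `k` of `u` (meaningful when the block is constant). -/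
noncomputable def bv (p : ℕ) (S : Fin M → ℕ) (u : Fin n → Bool) (k : Fin M) : Bool :=
  decide (∀ i : Fin n, (S k ≤ i.val ∧ i.val < S k + p) → u i = true)

/-- the PIECE MAP: re-set every constant block `k` of `u` to the constant `w k`; everything else stays. -/
noncomputable def Bset (p : ℕ) (S : Fin M → ℕ) (u : Fin n → Bool) (w : Fin M → Bool) : Fin n → Bool := fun i =>
  if h : ∃ k, (S k ≤ i.val ∧ i.val < S k + p) ∧ (∀ x₁ x₂ : Fin n, (S k ≤ x₁.val ∧ x₁.val < S k + p) → (S k ≤ x₂.val ∧ x₂.val < S k + p) → u x₁ = u x₂) then w h.choose else u i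

/-- the complementary coordinates of the piece involution. -/
noncomputable def mix (p : ℕ) (S : Fin M → ℕ) (u : Fin n → Bool) (w : Fin M → Bool) : Fin M → Bool := fun k =>
  if (∀ x₁ x₂ : Fin n, (S k ≤ x₁.val ∧ x₁.val < S k + p) → (S k ≤ x₂.val ∧ x₂.val < S k + p) → u x₁ = u x₂) then bv p S u k else w k

/-- on a constant block `k` the piece point carries the bit `w k`. -/
theorem Bset_of_const (h : ((∀ k k', k < k' → S k + p ≤ S k') ∧ (∀ k, S k + p ≤ n))) (u : Fin n → Bool) (w : Fin M → Bool) {k : Fin M} {i : Fin n}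
    (hki : (S k ≤ i.val ∧ i.val < S k + p)) (hc : (∀ x₁ x₂ : Fin n, (S k ≤ x₁.val ∧ x₁.val < S k + p) → (S k ≤ x₂.val ∧ x₂.val < S k + p) → u x₁ = u x₂)) : Bset p S u w i = w k := by
  unfold Bset
  have hex : ∃ k, (S k ≤ i.val ∧ i.val < S k + p) ∧ (∀ x₁ x₂ : Fin n, (S k ≤ x₁.val ∧ x₁.val < S k + p) → (S k ≤ x₂.val ∧ x₂.val < S k + p) → u x₁ = u x₂) := ⟨k, hki, hc⟩
  rw [dif_pos hex, inBlk_unique h hex.choose_spec.1 hki]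

/-- off the constant blocks the piece point agrees with `u`. -/
theorem Bset_of_not (u : Fin n → Bool) (w : Fin M → Bool) {i : Fin n}
    (hx : ¬ ∃ k, (S k ≤ i.val ∧ i.val < S k + p) ∧ (∀ x₁ x₂ : Fin n, (S k ≤ x₁.val ∧ x₁.val < S k + p) → (S k ≤ x₂.val ∧ x₂.val < S k + p) → u x₁ = u x₂)) : Bset p S u w i = u i := by
  unfold Bset
  rw [dif_neg hx]

/-- on a NON-constant block the piece point agrees with `u`. -/
theorem Bset_of_not_const (h : ((∀ k k', k < k' → S k + p ≤ S k') ∧ (∀ k, S k + p ≤ n))) (u : Fin n → Bool) (w : Fin M → Bool) {k : Fin M} {i : Fin n}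
    (hki : (S k ≤ i.val ∧ i.val < S k + p)) (hc : ¬ (∀ x₁ x₂ : Fin n, (S k ≤ x₁.val ∧ x₁.val < S k + p) → (S k ≤ x₂.val ∧ x₂.val < S k + p) → u x₁ = u x₂)) : Bset p S u w i = u i := by
  refine Bset_of_not u w fun ⟨k', hk', hc'⟩ => hc ?_
  rw [inBlk_unique h hki hk']
  exact hc'

/-- the piece map preserves which blocks are constant. -/
theorem isConst_Bset (h : ((∀ k k', k < k' → S k + p ≤ S k') ∧ (∀ k, S k + p ≤ n))) (u : Fin n → Bool) (w : Fin M → Bool) (k : Fin M) :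
    (∀ x₁ x₂ : Fin n, (S k ≤ x₁.val ∧ x₁.val < S k + p) → (S k ≤ x₂.val ∧ x₂.val < S k + p) → (Bset p S u w) x₁ = (Bset p S u w) x₂) ↔ (∀ x₁ x₂ : Fin n, (S k ≤ x₁.val ∧ x₁.val < S k + p) → (S k ≤ x₂.val ∧ x₂.val < S k + p) → u x₁ = u x₂) := by
  constructor
  · intro hc
    by_contra hnc
    apply hnc
    intro i i' hi hi'
    have e := hc i i' hi hi'
    rwa [Bset_of_not_const h u w hi hnc, Bset_of_not_const h u w hi' hnc] at e
  · intro hc i i' hi hi'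
    rw [Bset_of_const h u w hi hc, Bset_of_const h u w hi' hc]

/-- the first coordinate of a block (blocks are non-empty when `1 ≤ p`). -/
theorem exists_inBlk (h : ((∀ k k', k < k' → S k + p ≤ S k') ∧ (∀ k, S k + p ≤ n))) (hp : 1 ≤ p) (k : Fin M) : ∃ i : Fin n, (S k ≤ i.val ∧ i.val < S k + p) :=
  ⟨⟨S k, by have := h.2 k; omega⟩, by simp, by simp; omega⟩

/-- on a constant block the carried bit is the value. -/
theorem bv_eq_of_const {u : Fin n → Bool} {k : Fin M} {i : Fin n} (hki : (S k ≤ i.val ∧ i.val < S k + p)) (hc : (∀ x₁ x₂ : Fin n, (S k ≤ x₁.val ∧ x₁.val < S k + p) → (S k ≤ x₂.val ∧ x₂.val < S k + p) → u x₁ = u x₂)) :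
    bv p S u k = u i := by
  unfold bv
  cases hu : u i
  · rw [decide_eq_false_iff_not]
    intro hall
    have := hall i hki
    rw [hu] at this
    exact Bool.false_ne_true this
  · rw [decide_eq_true_iff]
    intro i' hi'
    rw [← hu]
    exact hc i' i hi' hki

/-- the piece involution, first coordinate: re-setting the re-set blocks to the original bits gives `u` back. -/
theorem Bset_Bset_mix (h : ((∀ k k', k < k' → S k + p ≤ S k') ∧ (∀ k, S k + p ≤ n))) (u : Fin n → Bool) (w : Fin M → Bool) :
    Bset p S (Bset p S u w) (mix p S u w) = u := by
  funext i
  by_cases hx : ∃ k, (S k ≤ i.val ∧ i.val < S k + p) ∧ (∀ x₁ x₂ : Fin n, (S k ≤ x₁.val ∧ x₁.val < S k + p) → (S k ≤ x₂.val ∧ x₂.val < S k + p) → u x₁ = u x₂)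
  · obtain ⟨k, hki, hc⟩ := hx
    rw [Bset_of_const h _ _ hki ((isConst_Bset h u w k).mpr hc), mix, if_pos hc, bv_eq_of_const hki hc]
  · have hx' : ¬ ∃ k, (S k ≤ i.val ∧ i.val < S k + p) ∧ (∀ x₁ x₂ : Fin n, (S k ≤ x₁.val ∧ x₁.val < S k + p) → (S k ≤ x₂.val ∧ x₂.val < S k + p) → (Bset p S u w) x₁ = (Bset p S u w) x₂) := by
      rintro ⟨k, hki, hc⟩
      exact hx ⟨k, hki, (isConst_Bset h u w k).mp hc⟩
    rw [Bset_of_not _ _ hx', Bset_of_not _ _ hx]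

/-- the piece involution, second coordinate. -/
theorem mix_Bset_mix (h : ((∀ k k', k < k' → S k + p ≤ S k') ∧ (∀ k, S k + p ≤ n))) (hp : 1 ≤ p) (u : Fin n → Bool) (w : Fin M → Bool) :
    mix p S (Bset p S u w) (mix p S u w) = w := by
  funext k
  unfold mix
  by_cases hc : (∀ x₁ x₂ : Fin n, (S k ≤ x₁.val ∧ x₁.val < S k + p) → (S k ≤ x₂.val ∧ x₂.val < S k + p) → u x₁ = u x₂)
  · obtain ⟨i, hki⟩ := exists_inBlk h hp k
    rw [if_pos ((isConst_Bset h u w k).mpr hc), bv_eq_of_const hki ((isConst_Bset h u w k).mpr hc),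
      Bset_of_const h u w hki hc]
  · have hc' : ¬ (∀ x₁ x₂ : Fin n, (S k ≤ x₁.val ∧ x₁.val < S k + p) → (S k ≤ x₂.val ∧ x₂.val < S k + p) → (Bset p S u w) x₁ = (Bset p S u w) x₂) := fun hh => hc ((isConst_Bset h u w k).mp hh)
    rw [if_neg hc', if_neg hc]

/-- **TILING BY PIECES (double counting)**: summing, over all inputs `u`, the number of piece parameters `w` whose piece point has a
property counts every input with the property exactly `2^M` times. -/
theorem sum_card_Bset (h : ((∀ k k', k < k' → S k + p ≤ S k') ∧ (∀ k, S k + p ≤ n))) (hp : 1 ≤ p) (P : (Fin n → Bool) → Prop) [DecidablePred P] :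
    ∑ u : Fin n → Bool, (univ.filter fun w : Fin M → Bool => P (Bset p S u w)).card
      = 2 ^ M * (univ.filter fun u : Fin n → Bool => P u).card := by
  let Φ : (Fin n → Bool) × (Fin M → Bool) → (Fin n → Bool) × (Fin M → Bool) :=
    fun q => (Bset p S q.1 q.2, mix p S q.1 q.2)
  have hΦ : Function.Involutive Φ := by
    rintro ⟨u, w⟩
    simp only [Φ, Prod.mk.injEq]
    exact ⟨Bset_Bset_mix h u w, mix_Bset_mix h hp u w⟩
  have h1 : ∀ u : Fin n → Bool, (univ.filter fun w : Fin M → Bool => P (Bset p S u w)).card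
      = ∑ w : Fin M → Bool, (if P (Bset p S u w) then 1 else 0) := fun u => Finset.card_filter _ _
  simp_rw [h1]
  have h3 : (∑ u : Fin n → Bool, ∑ w : Fin M → Bool, (if P (Bset p S u w) then 1 else 0))
      = ∑ q : (Fin n → Bool) × (Fin M → Bool), (if P (Bset p S q.1 q.2) then 1 else 0) :=
    (Fintype.sum_prod_type' (fun u w => if P (Bset p S u w) then (1 : ℕ) else 0)).symm
  have h2 := hΦ.bijective.sum_comp (fun q : (Fin n → Bool) × (Fin M → Bool) => if P q.1 then (1 : ℕ) else 0)
  rw [h3]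
  rw [show (∑ q : (Fin n → Bool) × (Fin M → Bool), (if P (Bset p S q.1 q.2) then (1 : ℕ) else 0))
      = ∑ q : (Fin n → Bool) × (Fin M → Bool), (if P q.1 then (1 : ℕ) else 0) from h2]
  rw [Fintype.sum_prod_type, Finset.card_filter, Finset.mul_sum]
  refine Finset.sum_congr rfl fun u _ => ?_
  show (∑ _w : Fin M → Bool, (if P u then (1 : ℕ) else 0)) = _
  rw [Finset.sum_const, Finset.card_univ, Fintype.card_fun, Fintype.card_bool, Fintype.card_fin, smul_eq_mul]

/-- **the piece bound transported to the cube**: if `u` has enough constant blocks, at most `θ·2^M` of the `2^M` piece parameters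
`w` give a winning piece point (reduction to `blockPiece_hard` on the constant blocks, re-indexed increasingly). -/
theorem card_Bset_win_le (h : ((∀ k k', k < k' → S k + p ≤ S k') ∧ (∀ k, S k + p ≤ n))) {θ : ℝ} {N₀ L : ℕ} (c : ℕ) (D : JLinPeel.JLinData p n)
    (hpiece : ∀ (N : ℕ) (s : Fin N → ℕ), ((∀ k k', k < k' → s k + p ≤ s k') ∧ (∀ k, s k + p ≤ n)) → N₀ ≤ N → (L + 1) * (L + 1) ≤ N →
      (∀ g (k : Fin N) (i i' : Fin n), (s k ≤ i.val ∧ i.val < s k + p) → (s k ≤ i'.val ∧ i'.val < s k + p) → D.a g i = D.a g i') →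
      ∀ u : Fin n → Bool,
        ((univ.filter fun v : Fin N → Bool => ringWinU c D.strat (bset p s u v) = true).card : ℝ) ≤ θ * (2 : ℝ) ^ N)
    (hconst : ∀ g (k : Fin M) (i i' : Fin n), (S k ≤ i.val ∧ i.val < S k + p) → (S k ≤ i'.val ∧ i'.val < S k + p) → D.a g i = D.a g i')
    (u : Fin n → Bool) (hN₀ : N₀ ≤ (cblk p S u).card) (hL : (L + 1) * (L + 1) ≤ (cblk p S u).card) :
    ((univ.filter fun w : Fin M → Bool => ringWinU c D.strat (Bset p S u w) = true).card : ℝ) ≤ θ * (2 : ℝ) ^ M := by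
  set W : Finset (Fin M) := univ \ cblk p S u with hW
  let a : Fin M → Bool := fun _ => false
  let s' : Fin (M - W.card) → ℕ := fun j => S (Subcube.emb W j)
  have hWc : W.card + (cblk p S u).card = M := by
    rw [hW, Finset.card_sdiff_add_card_eq_card (subset_univ _), card_univ, Fintype.card_fin]
  have hMW : M - W.card = (cblk p S u).card := by omega
  have hmemF : ∀ {k : Fin M}, k ∉ W ↔ (∀ x₁ x₂ : Fin n, (S k ≤ x₁.val ∧ x₁.val < S k + p) → (S k ≤ x₂.val ∧ x₂.val < S k + p) → u x₁ = u x₂) := by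
    intro k
    rw [hW, mem_sdiff, cblk, mem_filter]
    simp only [Finset.mem_univ, true_and, not_not]
  have hs' : ((∀ k k', k < k' → s' k + p ≤ s' k') ∧ (∀ k, s' k + p ≤ n)) :=
    ⟨fun j j' hjj => h.1 _ _ (Subcube.emb_strictMono W hjj), fun j => h.2 _⟩
  have hext : ∀ v : Fin (M - W.card) → Bool, Bset p S u (Subcube.ext W a v) = bset p s' u v := by
    intro v
    funext i
    by_cases hx : ∃ k, (S k ≤ i.val ∧ i.val < S k + p) ∧ (∀ x₁ x₂ : Fin n, (S k ≤ x₁.val ∧ x₁.val < S k + p) → (S k ≤ x₂.val ∧ x₂.val < S k + p) → u x₁ = u x₂)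
    · obtain ⟨k, hki, hc⟩ := hx
      have hkW : k ∉ W := hmemF.mpr hc
      have hj : (s' (Subcube.idx W k hkW) ≤ i.val ∧ i.val < s' (Subcube.idx W k hkW) + p) := by
        show S (Subcube.emb W (Subcube.idx W k hkW)) ≤ i.val ∧ i.val < S (Subcube.emb W (Subcube.idx W k hkW)) + p
        rw [Subcube.emb_idx]
        exact hki
      rw [Bset_of_const h u _ hki hc, bset_of_inBlk hs' u v hj]
      unfold Subcube.ext
      rw [dif_neg hkW]
    · rw [Bset_of_not u _ hx, bset_of_not_inBlk u v fun j hj => hx ⟨Subcube.emb W j, hj, hmemF.mp (Subcube.emb_not_mem W j)⟩]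
  have hdepW : ∀ w : Fin M → Bool, Bset p S u (AffBells22.subcubeMerge W a w) = Bset p S u w := by
    intro w
    funext i
    unfold Bset
    by_cases hx : ∃ k, (S k ≤ i.val ∧ i.val < S k + p) ∧ (∀ x₁ x₂ : Fin n, (S k ≤ x₁.val ∧ x₁.val < S k + p) → (S k ≤ x₂.val ∧ x₂.val < S k + p) → u x₁ = u x₂)
    · rw [dif_pos hx, dif_pos hx]
      unfold AffBells22.subcubeMerge
      rw [if_neg (hmemF.mpr hx.choose_spec.2)]
    · rw [dif_neg hx, dif_neg hx]
  have e1 : (univ.filter fun w : Fin M → Bool => ringWinU c D.strat (Bset p S u w) = true)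
      = univ.filter fun w : Fin M → Bool => ringWinU c D.strat (Bset p S u (AffBells22.subcubeMerge W a w)) = true := by
    refine Finset.filter_congr fun w _ => ?_
    rw [hdepW]
  have e2 : (univ.filter fun v : Fin (M - W.card) → Bool => ringWinU c D.strat (Bset p S u (Subcube.ext W a v)) = true)
      = univ.filter fun v : Fin (M - W.card) → Bool => ringWinU c D.strat (bset p s' u v) = true := by
    refine Finset.filter_congr fun v _ => ?_
    rw [hext]
  have hmul := Subcube.card_filter_merge_le W a (fun w : Fin M → Bool => ringWinU c D.strat (Bset p S u w) = true)
  rw [← e1, e2] at hmul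
  have hp' := hpiece (M - W.card) s' hs' (by rw [hMW]; exact hN₀) (by rw [hMW]; exact hL)
    (fun g j i i' hi hi' => hconst g _ i i' hi hi') u
  have hpow : (2 : ℝ) ^ W.card * (2 : ℝ) ^ (M - W.card) = (2 : ℝ) ^ M := by
    rw [← pow_add, Subcube.card_add_sub]
  calc ((univ.filter fun w : Fin M → Bool => ringWinU c D.strat (Bset p S u w) = true).card : ℝ)
      ≤ (2 : ℝ) ^ W.card
          * ((univ.filter fun v : Fin (M - W.card) → Bool => ringWinU c D.strat (bset p s' u v) = true).card : ℝ) := by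
        exact_mod_cast hmul
    _ ≤ (2 : ℝ) ^ W.card * (θ * (2 : ℝ) ^ (M - W.card)) := by
        exact mul_le_mul_of_nonneg_left hp' (by positivity)
    _ = θ * (2 : ℝ) ^ M := by rw [← hpow]; ring


end BlockDial

end Summit.QuantumAdvantage.AdviceFreeQNC0.JLinPeel.BlockDial
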